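import Summits.HodgeConjecture.HodgeConjecture.Theses.MirrorBraneLift

/-!
# Birth skeleton (BC3) — crux `LagrangianLift` of route `MirrorBraneLift`

Crux item `stmt-HodgeConjecture-18677`, decl
`Summit.HodgeConjecture.HodgeConjecture.Theses.MirrorBraneLift.LagrangianLift` (A, Hicks's geometric
A-realizability for effective tropical `n`-cycles on the tropical Weil tori `B_Q = ℝ²ⁿ/Qℤ²ⁿ`): for
`n ≥ 2`, `δ ≥ 1`, `P ∈ 𝓛_δ⁺`, every `V : TropicalTorusCycle (2 * n) n P.Q` and every `ε > 0` there is a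
compact Hausdorff smooth `2n`-manifold `L` and `f : L → 𝕏(B_Q) = CotangentTorus P.Q` with
`IsGeometricLift P.Q V ε f` (graded Lagrangian immersion, `ε`-close to `|V|` over the base, equal to the
periodised conormal sheets with multiplicity over the `ε`-cores).

## The seam (the route header's TWO-LAYER PLAN "A ⇐ immersedLift → grading → A", typed)

`IsGeometricLift = lagrangian ∧ graded ∧ close ∧ conormal`.  Over the `ε`-core of a top cell `σ` a lift
IS the affine sheet `core_ε(σ) × (a_j + L_σ^⊥)`, whose complexified tangent frame is
`Z = [u₁ … u_n | i·v₁ … i·v_n]` (`u` a basis of `L_σ`, `v` of `L_σ^⊥`), so `det Z² = (-1)ⁿ det_ℝ[u|v]²`: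
EVERY flat sheet has the same constant squared phase `(-1)ⁿ`.  Hence the Maslov class of any immersed
lift is carried by the necks over the `ε`-neighbourhood of the codimension-one skeleton, and the
grading question separates cleanly from the construction question:

* `stub_orientedImmersedLift` — THE CONSTRUCTION (size L; Hicks's conjectured A-realizability minus the
  grading): an UNGRADED geometric lift exists — a Lagrangian immersion of a compact Hausdorff smooth
  `2n`-manifold, `ε`-close to `|V|`, conormal with multiplicity over the `ε`-cores — whose squared phase
  map `x ↦ det(Z_x)²/|det(Z_x)|² : L → U(1)` admits a continuous SQUARE ROOT `ψ`.  For a Lagrangian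
  immersion into the flat Calabi–Yau torus `𝕏` (holomorphic volume form `dz₁ ∧ … ∧ dz₂ₙ`, and
  `det Z_x = (dz₁ ∧ … ∧ dz₂ₙ)(frame)`) such a `ψ` exists iff the Maslov class `μ_f ∈ H¹(L;ℤ)` is EVEN
  iff `L` is orientable (`μ_f mod 2 = w₁(TL)`; Seidel, *Graded Lagrangian submanifolds*, §2), so this
  is "an ORIENTABLE immersed Lagrangian lift exists" — what gluing oriented local models (Lagrangian
  pairs of pants × flat factors over facets, Hicks2025Realizability §3 / Mikhalkin2019TropicalLagrangian
  for curves and hypersurfaces; the codimension-`n` strata are the open part) would produce.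
* `stub_regrading` — THE REPAIR (size M/L; Gromov–Lees): an orientable (Maslov-even) ungraded lift
  `f : L → 𝕏` of `V` at scale `ε` can be replaced by a GRADED geometric lift `f' : L → 𝕏` of `V` at the
  same scale on the SAME manifold.  Mechanism: `μ_f = 2c`; `μ_f` vanishes on `K = f⁻¹(over the cores)`
  (constant phase there) and `H¹(K;ℤ)` is torsion-free, so `c|_K = 0` and `c|_U = 0` on a neighbourhood
  `U ⊇ K`; pick `g : L → U(1)`, `g ≡ 1` on `U`, `[g] = -c`; the formal Lagrangian monomorphism
  `diag(g,1,…,1) ∘ df` has Maslov class `0`, and the RELATIVE `C⁰`-DENSE h-principle for Lagrangian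
  immersions (Gromov 1986 PDR 3.4.2; Lees 1976; Eliashberg–Mishachev §16.3 — `f^*ω₀ = 0` holds) gives a
  Lagrangian immersion `f'`, `= f` on `U`, `η`-close to `f` in `C⁰`, with `μ_{f'} = 0` (graded).  For
  `η` below the closeness slack `ε - max_x dist(base f x, |V|)` (compactness) `f'` is `ε`-close, and
  for `η` below `dist(f(L ∖ U), over-cores) > 0` no new point lands over a core, so `f'` is conormal
  over the cores with the same sheets.  [McDuffSalamon2017 §2.3 (Maslov class); Gromov–Lees]

`LagrangianLift_of` is the real (sorry-free) composition: take `(L, f, ψ)` from stub 1, regrade by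
stub 2, repackage.  Neither stub alone gives the crux (stub 1 produces no grading; stub 2 produces
nothing without an oriented lift) nor `HodgeConjecture`; BC3 probes (`stub → LagrangianLift`,
`stub → HodgeConjecture` by `first | exact? | simpa | aesop`) are run in the seat's `bc/` probe file and
all fail (NOTES.md of planner-skel-stmt-HodgeConjecture-18677-0).  The crux implies both stubs
(graded ⇒ `ψ = exp(iθ/2)`; and its conclusion outright up to the choice of `L`), so the split loses
no strength beyond "same `L`" in stub 2.
Disproof used: none (no `Disproof.lean` on this crux yet).  Dead lines: none recorded.
-/

namespace Summit.HodgeConjecture.HodgeConjecture.Cruxes.LagrangianLift.Birth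

open Summit.HodgeConjecture.HodgeConjecture.Theses.MirrorBraneLift
open scoped Manifold ContDiff Matrix

noncomputable section

/-- **Stub 1 — oriented immersed (ungraded) geometric lift.** For `n ≥ 2`, `δ ≥ 1`, `P ∈ 𝓛_δ⁺`, every
effective tropical `n`-cycle `V` on `B_Q` and every `ε > 0` there are a compact Hausdorff smooth
`2n`-manifold `L` and `f : L → 𝕏(B_Q)` which is a Lagrangian immersion, `ε`-close to `|V|` over the
base, conormal with multiplicity over the `ε`-cores (the three non-grading fields of
`IsGeometricLift`), and whose squared phase `det(Z_x)²/|det(Z_x)|²` has a continuous square root `ψ`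
(Maslov class even ⟺ `L` orientable). [cite: Hicks2025Realizability, Def. 3.0.2 and p. 4]
[cite: Mikhalkin2019TropicalLagrangian, §§1–2] [cite: McDuffSalamon2017, §2.3] -/
theorem stub_orientedImmersedLift :
    ∀ (n : ℕ), 2 ≤ n → ∀ (δ : ℕ), 1 ≤ δ →
      ∀ (P : Literature.AlgebraicGeometry.Tropical.WeilFamily.Polarization n δ)
        (V : Literature.AlgebraicGeometry.Tropical.TropicalTorusCycle (2 * n) n P.Q) (ε : ℝ), 0 < ε →
      ∃ (L : Type) (_ : TopologicalSpace L) (_ : T2Space L) (_ : CompactSpace L)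
        (_ : ChartedSpace (EuclideanSpace ℝ (Fin (2 * n))) L)
        (_ : IsManifold 𝓘(ℝ, EuclideanSpace ℝ (Fin (2 * n))) ((⊤ : ℕ∞) : WithTop ℕ∞) L)
        (f : L → Literature.Geometry.Symplectic.CotangentTorus P.Q),
        Literature.Geometry.Symplectic.IsLagrangianImmersion P.Q f ∧
        (∀ x : L, ∃ (σ : Fin V.numCells) (z : Fin (2 * n) → ℤ) (b : Fin (2 * n) → ℝ),
            b ∈ Literature.Geometry.Symplectic.cellHull P.Q V σ ∧
            dist (Literature.Geometry.Symplectic.CotangentTorus.baseRep P.Q (f x))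
              (b + P.Q *ᵥ (fun i => (z i : ℝ))) < ε) ∧
        Literature.Geometry.Symplectic.IsConormalOver P.Q V ε f ∧
        (∃ ψ : L → ℂ, Continuous ψ ∧ ∀ x : L,
            (Literature.Geometry.Symplectic.tangentFrame P.Q f x).det ^ 2 =
              ((‖(Literature.Geometry.Symplectic.tangentFrame P.Q f x).det‖ ^ 2 : ℝ) : ℂ) * ψ x ^ 2) := by
  sorry

/-- **Stub 2 — regrading (relative `C⁰`-dense h-principle for Lagrangian immersions).** An orientable
(Maslov-even: the squared phase has a continuous square root) ungraded geometric lift `f : L → 𝕏(B_Q)`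
of `V` at scale `ε` — Lagrangian immersion, `ε`-close, conormal over the `ε`-cores — can be replaced
by a GRADED geometric lift `f' : L → 𝕏(B_Q)` of `V` at the same scale on the same compact manifold
(twist the formal Lagrangian monomorphism by `g : L → U(1)` killing `μ_f/2`, `g ≡ 1` near the cores,
and integrate it by Gromov–Lees relative to the cores, `C⁰`-small). [cite: McDuffSalamon2017, §2.3]
[cite: Hicks2025Realizability, Def. 3.0.2] -/
theorem stub_regrading :
    ∀ (n : ℕ), 2 ≤ n → ∀ (δ : ℕ), 1 ≤ δ →
      ∀ (P : Literature.AlgebraicGeometry.Tropical.WeilFamily.Polarization n δ)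
        (V : Literature.AlgebraicGeometry.Tropical.TropicalTorusCycle (2 * n) n P.Q) (ε : ℝ), 0 < ε →
      ∀ (L : Type) [TopologicalSpace L] [T2Space L] [CompactSpace L]
        [ChartedSpace (EuclideanSpace ℝ (Fin (2 * n))) L]
        [IsManifold 𝓘(ℝ, EuclideanSpace ℝ (Fin (2 * n))) ((⊤ : ℕ∞) : WithTop ℕ∞) L]
        (f : L → Literature.Geometry.Symplectic.CotangentTorus P.Q),
        Literature.Geometry.Symplectic.IsLagrangianImmersion P.Q f →
        (∀ x : L, ∃ (σ : Fin V.numCells) (z : Fin (2 * n) → ℤ) (b : Fin (2 * n) → ℝ),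
            b ∈ Literature.Geometry.Symplectic.cellHull P.Q V σ ∧
            dist (Literature.Geometry.Symplectic.CotangentTorus.baseRep P.Q (f x))
              (b + P.Q *ᵥ (fun i => (z i : ℝ))) < ε) →
        Literature.Geometry.Symplectic.IsConormalOver P.Q V ε f →
        (∃ ψ : L → ℂ, Continuous ψ ∧ ∀ x : L,
            (Literature.Geometry.Symplectic.tangentFrame P.Q f x).det ^ 2 =
              ((‖(Literature.Geometry.Symplectic.tangentFrame P.Q f x).det‖ ^ 2 : ℝ) : ℂ) * ψ x ^ 2) →
        ∃ f' : L → Literature.Geometry.Symplectic.CotangentTorus P.Q,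
          Literature.Geometry.Symplectic.IsGeometricLift P.Q V ε f' := by
  sorry

/-! ## Name-keyed aliases of the two statements — the hypotheses of `LagrangianLift_of`
The skeleton audit (`#h21_check_skeleton`) admits a hypothesis of the skeleton theorem only if its head
constant is a registered obligation or is NAMED like a declared stub; `__Registered.stub_X` is the statement
of `stub_X` verbatim under the stub's short name (device of `Cruxes/AlgebraicDensity/Lines/birth.lean` and
`Cruxes/TropicalWeilVanishing/Lines/birth.lean`).  The corollary `LagrangianLift_of_stubs` checks by
definitional unfolding that each alias IS its stub's statement. -/
namespace __Registered

/-- Statement of `stub_orientedImmersedLift`, keyed by the registered stub name. -/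
abbrev stub_orientedImmersedLift : Prop :=
  ∀ (n : ℕ), 2 ≤ n → ∀ (δ : ℕ), 1 ≤ δ →
    ∀ (P : Literature.AlgebraicGeometry.Tropical.WeilFamily.Polarization n δ)
      (V : Literature.AlgebraicGeometry.Tropical.TropicalTorusCycle (2 * n) n P.Q) (ε : ℝ), 0 < ε →
    ∃ (L : Type) (_ : TopologicalSpace L) (_ : T2Space L) (_ : CompactSpace L)
      (_ : ChartedSpace (EuclideanSpace ℝ (Fin (2 * n))) L)
      (_ : IsManifold 𝓘(ℝ, EuclideanSpace ℝ (Fin (2 * n))) ((⊤ : ℕ∞) : WithTop ℕ∞) L)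
      (f : L → Literature.Geometry.Symplectic.CotangentTorus P.Q),
      Literature.Geometry.Symplectic.IsLagrangianImmersion P.Q f ∧
      (∀ x : L, ∃ (σ : Fin V.numCells) (z : Fin (2 * n) → ℤ) (b : Fin (2 * n) → ℝ),
          b ∈ Literature.Geometry.Symplectic.cellHull P.Q V σ ∧
          dist (Literature.Geometry.Symplectic.CotangentTorus.baseRep P.Q (f x))
            (b + P.Q *ᵥ (fun i => (z i : ℝ))) < ε) ∧
      Literature.Geometry.Symplectic.IsConormalOver P.Q V ε f ∧
      (∃ ψ : L → ℂ, Continuous ψ ∧ ∀ x : L,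
          (Literature.Geometry.Symplectic.tangentFrame P.Q f x).det ^ 2 =
            ((‖(Literature.Geometry.Symplectic.tangentFrame P.Q f x).det‖ ^ 2 : ℝ) : ℂ) * ψ x ^ 2)

/-- Statement of `stub_regrading`, keyed by the registered stub name. -/
abbrev stub_regrading : Prop :=
  ∀ (n : ℕ), 2 ≤ n → ∀ (δ : ℕ), 1 ≤ δ →
    ∀ (P : Literature.AlgebraicGeometry.Tropical.WeilFamily.Polarization n δ)
      (V : Literature.AlgebraicGeometry.Tropical.TropicalTorusCycle (2 * n) n P.Q) (ε : ℝ), 0 < ε →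
    ∀ (L : Type) [TopologicalSpace L] [T2Space L] [CompactSpace L]
      [ChartedSpace (EuclideanSpace ℝ (Fin (2 * n))) L]
      [IsManifold 𝓘(ℝ, EuclideanSpace ℝ (Fin (2 * n))) ((⊤ : ℕ∞) : WithTop ℕ∞) L]
      (f : L → Literature.Geometry.Symplectic.CotangentTorus P.Q),
      Literature.Geometry.Symplectic.IsLagrangianImmersion P.Q f →
      (∀ x : L, ∃ (σ : Fin V.numCells) (z : Fin (2 * n) → ℤ) (b : Fin (2 * n) → ℝ),
          b ∈ Literature.Geometry.Symplectic.cellHull P.Q V σ ∧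
          dist (Literature.Geometry.Symplectic.CotangentTorus.baseRep P.Q (f x))
            (b + P.Q *ᵥ (fun i => (z i : ℝ))) < ε) →
      Literature.Geometry.Symplectic.IsConormalOver P.Q V ε f →
      (∃ ψ : L → ℂ, Continuous ψ ∧ ∀ x : L,
          (Literature.Geometry.Symplectic.tangentFrame P.Q f x).det ^ 2 =
            ((‖(Literature.Geometry.Symplectic.tangentFrame P.Q f x).det‖ ^ 2 : ℝ) : ℂ) * ψ x ^ 2) →
      ∃ f' : L → Literature.Geometry.Symplectic.CotangentTorus P.Q,
        Literature.Geometry.Symplectic.IsGeometricLift P.Q V ε f'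

end __Registered

/-- **Composition (real proof) — THE SKELETON THEOREM.** Given `n, δ, P, V, ε`: stub 1 supplies a
compact Hausdorff smooth `2n`-manifold `L` with an orientable ungraded geometric lift `f` of `V` at scale
`ε`; stub 2 regrades it on the same `L` to `f'` with `IsGeometricLift P.Q V ε f'`; repackage the
witnesses.  Hypotheses = the two stub statements (name-keyed aliases); concludes the route decl
`LagrangianLift` BY NAME. -/
theorem LagrangianLift_of :
    __Registered.stub_orientedImmersedLift → __Registered.stub_regrading → LagrangianLift := by
  intro h₁ h₂ n hn δ hδ P V ε hε
  obtain ⟨L, i₁, i₂, i₃, i₄, i₅, f, hf, hclose, hconormal, hψ⟩ := h₁ n hn δ hδ P V ε hε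
  obtain ⟨f', hf'⟩ := @h₂ n hn δ hδ P V ε hε L i₁ i₂ i₃ i₄ i₅ f hf hclose hconormal hψ
  exact ⟨L, i₁, i₂, i₃, i₄, i₅, f', hf'⟩

/-- **The crux, closed modulo exactly the two registered stubs** (sanity: the stubs compose, and each
alias is its stub's statement). -/
theorem LagrangianLift_of_stubs : LagrangianLift :=
  LagrangianLift_of stub_orientedImmersedLift stub_regrading

end

end Summit.HodgeConjecture.HodgeConjecture.Cruxes.LagrangianLift.Birth
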